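import Literature.NumberTheory.Automorphic.BLZPeriodCocycleProofs
import Literature.NumberTheory.Automorphic.BLZPeriodCocycleAnalyticityProofs
import Literature.NumberTheory.Automorphic.PiecewiseRational
import Literature.NumberTheory.Automorphic.PrincipalSeriesLineModel
import Literature.NumberTheory.EllipticCurves.HeckeOperatorsGamma1QExpansionProofs
import Literature.NumberTheory.Automorphic.InvariantLaplacian
import Literature.NumberTheory.Automorphic.SmallEigenbasisIndependence

/-!
# Hecke stability of the rational period structure — part 1/4: definitions and bridges
(crux `RationalPeriodQuarter.HeckePreservesRationalPeriods`, item stmt-Langlands-2807)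

Named forms of the route's inlined `let`-helpers (`slashHalfR`, `IsQuarterCuspFormR`, `lzCocycleR`, `IsPRQR`,
`IsSemiAnalyticR`, `HasRationalPeriodClassR`, the crux restated `HeckePreservesRationalPeriodsR`), the three
pieces of the split (`HeckeStableQuarterForms`, `HeckeCosetPermutation`, `HeckePeriodIntertwining`) with their
`Iff.rfl` unfoldings over the named Hecke data (`heckeMat`, `heckeAct`, `heckeT`), the bridges to the library
(`IsPRQ = IsPiecewiseRational ℚ`, `IsSemiAnalytic = IsSemiAnalyticVector`, `slashHalf = lineSlash (1/2) ∘ mapGL`,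
and the identification `lzCocycleR_eq` of the route's inlined period cocycle with the library's
`lewisZagierCocycle (1/2) I u (mapGL γ)`), the Hecke matrices as elements of `GL₂(ℝ)⁺`, and quarter cusp forms as
invariant eigenfunctions at `s = 1/2`.  No route file is imported here (parts 1–3 are route-independent).
(Provenance: part 1/4 of the verbatim re-cut of the registered, sorry-free crux line
`Summits/Langlands/Langlands/Cruxes/HeckePreservesRationalPeriods/Lines/decomposition.lean`
(planner-cstrat-stmt-Langlands-2807-r1, 2026-08-17, sha256 41344dedc33c…; re-verified rc 0 / 0 sorry / std axioms
2026-09-01) into `Theorems/` parts of at most 400 lines; namespace moved to `Theorems.HeckeRationalPeriods`, the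
route-file import confined to part 4/4.  References: Bruggeman–Lewis–Zagier, Mem. AMS 1118 (2015) (2.25), (5.4)–(5.5a);
Diamond–Shurman GTM 228 Prop. 5.2.1; Mühlenbruch, J. Number Theory 118 (2006) 208–235.)
-/

noncomputable section

set_option linter.dupNamespace false

open scoped MatrixGroups Topology ComplexConjugate
open Filter Set

namespace Summit.Langlands.Langlands.Theorems.HeckeRationalPeriods

open Literature.NumberTheory.Automorphic UpperHalfPlane

/-- The route's `slashHalf` (verbatim). -/
def slashHalfR : Matrix.SpecialLinearGroup (Fin 2) ℤ → (ℝ → ℂ) → ℝ → ℂ := fun g φ t => ((|((g : Matrix (Fin 2) (Fin 2) ℤ) 1 0 : ℝ) * t + ((g : Matrix (Fin 2) (Fin 2) ℤ) 1 1 : ℝ)|⁻¹ : ℝ) : ℂ) * φ ((((g : Matrix (Fin 2) (Fin 2) ℤ) 0 0 : ℝ) * t + ((g : Matrix (Fin 2) (Fin 2) ℤ) 0 1 : ℝ)) / (((g : Matrix (Fin 2) (Fin 2) ℤ) 1 0 : ℝ) * t + ((g : Matrix (Fin 2) (Fin 2) ℤ) 1 1 : ℝ)))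

/-- The route's `IsQuarterCuspForm` (verbatim). -/
def IsQuarterCuspFormR : ℕ → (UpperHalfPlane → ℂ) → Prop := fun N u => Literature.NumberTheory.Automorphic.IsC2 u ∧ (∀ γ ∈ CongruenceSubgroup.Gamma1 N, ∀ z : UpperHalfPlane, u (γ • z) = u z) ∧ (∀ z : UpperHalfPlane, Literature.NumberTheory.Automorphic.hypLaplacian u z + (1 / 4 : ℂ) * u z = 0) ∧ ∃ C : ℝ, ∀ z : UpperHalfPlane, ‖u z‖ ≤ C

/-- The route's `lzCocycle` (verbatim). (BruggemanLewisZagier2015, (5.4)–(5.5a)) -/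
def lzCocycleR : (UpperHalfPlane → ℂ) → Matrix.SpecialLinearGroup (Fin 2) ℤ → ℝ → ℂ := fun u γ t => ∫ τ in (0 : ℝ)..1, (let w : ℂ := (1 - (τ : ℂ)) * ((γ⁻¹ • UpperHalfPlane.I : UpperHalfPlane) : ℂ) + (τ : ℂ) * Complex.I; let dw : ℂ := Complex.I - ((γ⁻¹ • UpperHalfPlane.I : UpperHalfPlane) : ℂ); (fderiv ℝ (u ∘ UpperHalfPlane.ofComplex) w 1 - Complex.I * fderiv ℝ (u ∘ UpperHalfPlane.ofComplex) w Complex.I) / 2 * ((Real.sqrt w.im / ‖w - (t : ℂ)‖ : ℝ) : ℂ) * dw + (u ∘ UpperHalfPlane.ofComplex) w * (((fderiv ℝ (fun x : ℂ => Real.sqrt x.im / ‖x - (t : ℂ)‖) w 1 : ℝ) + Complex.I * (fderiv ℝ (fun x : ℂ => Real.sqrt x.im / ‖x - (t : ℂ)‖) w Complex.I : ℝ)) / 2) * (starRingEnd ℂ) dw)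

/-- The route's `IsPRQ` (verbatim). -/
def IsPRQR : (ℝ → ℂ) → Prop := fun φ => ∃ F : Finset ℚ, (∀ a b : ℚ, a < b → (∀ r ∈ F, r ≤ a ∨ b ≤ r) → ∃ P Q : Polynomial ℚ, ∀ x : ℝ, (a : ℝ) < x → x < b → Polynomial.aeval (x : ℂ) Q ≠ 0 ∧ φ x = Polynomial.aeval (x : ℂ) P / Polynomial.aeval (x : ℂ) Q) ∧ ∃ B : ℚ, (∃ P Q : Polynomial ℚ, ∀ x : ℝ, (B : ℝ) < x → Polynomial.aeval (x : ℂ) Q ≠ 0 ∧ φ x = Polynomial.aeval (x : ℂ) P / Polynomial.aeval (x : ℂ) Q) ∧ (∃ P Q : Polynomial ℚ, ∀ x : ℝ, x < -(B : ℝ) → Polynomial.aeval (x : ℂ) Q ≠ 0 ∧ φ x = Polynomial.aeval (x : ℂ) P / Polynomial.aeval (x : ℂ) Q)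

/-- The route's `IsSemiAnalytic` (verbatim). -/
def IsSemiAnalyticR : (ℝ → ℂ) → Prop := fun f => ∃ F : Finset ℝ, AnalyticOnNhd ℝ f ((↑F : Set ℝ)ᶜ)

/-- The route's `HasRationalPeriodClass` (verbatim, over the named helpers). -/
def HasRationalPeriodClassR : ℕ → (UpperHalfPlane → ℂ) → Prop := fun N u => ∃ (q : Matrix.SpecialLinearGroup (Fin 2) ℤ → ℝ → ℂ) (f : ℝ → ℂ), (∀ γ ∈ CongruenceSubgroup.Gamma1 N, IsPRQR (q γ)) ∧ (∀ γ ∈ CongruenceSubgroup.Gamma1 N, ∀ δ ∈ CongruenceSubgroup.Gamma1 N, ∀ᶠ t in Filter.cofinite, q (γ * δ) t = slashHalfR δ (q γ) t + q δ t) ∧ IsSemiAnalyticR f ∧ ∀ γ ∈ CongruenceSubgroup.Gamma1 N, ∀ᶠ t in Filter.cofinite, lzCocycleR u γ t = q γ t + slashHalfR γ f t - f t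

/-- The crux, restated over the named helpers. -/
def HeckePreservesRationalPeriodsR : Prop :=
  ∀ N : ℕ, 0 < N → ∀ p : ℕ, p.Prime → ¬ p ∣ N → ∀ σ ∈ CongruenceSubgroup.Gamma0 N, (((σ : Matrix (Fin 2) (Fin 2) ℤ) 1 1 : ℤ) : ZMod N) = (p : ZMod N) → ∀ u : UpperHalfPlane → ℂ, IsQuarterCuspFormR N u → HasRationalPeriodClassR N u → IsQuarterCuspFormR N (fun z : UpperHalfPlane => ((Real.sqrt p : ℝ) : ℂ)⁻¹ * (∑ b ∈ Finset.range p, u (UpperHalfPlane.ofComplex (((z : ℂ) + b) / p)) + u (σ • UpperHalfPlane.ofComplex ((p : ℂ) * (z : ℂ))))) ∧ HasRationalPeriodClassR N (fun z : UpperHalfPlane => ((Real.sqrt p : ℝ) : ℂ)⁻¹ * (∑ b ∈ Finset.range p, u (UpperHalfPlane.ofComplex (((z : ℂ) + b) / p)) + u (σ • UpperHalfPlane.ofComplex ((p : ℂ) * (z : ℂ)))))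

/-! ## Bridges -/

/-- The route's `IsPRQ` is the library's `IsPiecewiseRational ℚ` (definitional). -/
theorem isPRQR_iff (φ : ℝ → ℂ) : IsPRQR φ ↔ IsPiecewiseRational ℚ φ := Iff.rfl

/-- The route's semi-analyticity is the library's `IsSemiAnalyticVector` (definitional). -/
theorem isSemiAnalyticR_iff (f : ℝ → ℂ) : IsSemiAnalyticR f ↔ IsSemiAnalyticVector f := Iff.rfl

/-- The route's `slashHalf` on `SL₂(ℤ)` is the library's determinant-free `slashHalf` of the underlying integer matrix. -/
theorem slashHalfR_eq (g : SL(2, ℤ)) (φ : ℝ → ℂ) (t : ℝ) :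
    slashHalfR g φ t = Literature.NumberTheory.Automorphic.slashHalf (g : Matrix (Fin 2) (Fin 2) ℤ) φ t := rfl

/-- The route's `slashHalf` is the line-model slash `lineSlash (1/2)` by `mapGL γ`. -/
theorem slashHalfR_eq_lineSlash (g : SL(2, ℤ)) (φ : ℝ → ℂ) (t : ℝ) :
    slashHalfR g φ t = lineSlash (1 / 2) (Matrix.SpecialLinearGroup.mapGL ℝ g) φ t := by
  rw [lineSlash_mapGL_one_half]
  rfl

/-- The `SL₂(ℤ)`-action on `ℍ` factors through `mapGL` (definitional). -/
theorem sl_smul_eq_mapGL_smul (γ : SL(2, ℤ)) (z : ℍ) :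
    γ • z = (Matrix.SpecialLinearGroup.mapGL ℝ γ) • z := rfl


/-! ### The period cocycle: route integrand = library Green's form -/

/-- The real kernel used by the route: `f_t(x) = √(Im x) / |x - t|`. -/
def routeKernel (t : ℝ) (x : ℂ) : ℝ := Real.sqrt x.im / ‖x - (t : ℂ)‖

/-- The real kernel `√(Im x)/|x - t|` is real-differentiable on the upper half-plane. -/
theorem differentiableAt_routeKernel (t : ℝ) {w : ℂ} (hw : 0 < w.im) :
    DifferentiableAt ℝ (routeKernel t) w := by
  unfold routeKernel
  have him : DifferentiableAt ℝ (fun x : ℂ => x.im) w := Complex.imCLM.differentiableAt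
  have hsqrt : DifferentiableAt ℝ (fun x : ℂ => Real.sqrt x.im) w := him.sqrt hw.ne'
  have hsub : DifferentiableAt ℝ (fun x : ℂ => x - (t : ℂ)) w := differentiableAt_id.sub_const _
  have hne : w - (t : ℂ) ≠ 0 := by
    intro h
    have := congrArg Complex.im h
    simp at this
    exact hw.ne' this
  have hnorm : DifferentiableAt ℝ (fun x : ℂ => ‖x - (t : ℂ)‖) w := DifferentiableAt.norm ℝ hsub hne
  have hinv : DifferentiableAt ℝ (fun x : ℂ => (‖x - (t : ℂ)‖)⁻¹) w := hnorm.inv (norm_ne_zero_iff.mpr hne)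
  have h := hsqrt.mul hinv
  have e : (fun x : ℂ => Real.sqrt x.im / ‖x - (t : ℂ)‖) = fun x => Real.sqrt x.im * (‖x - (t : ℂ)‖)⁻¹ := by
    funext x; rw [div_eq_mul_inv]
  rw [e]; exact h

/-- Near a point of `ℍ`, the library kernel `R(t;·)^{1/2}` is the real kernel cast to `ℂ`. -/
theorem hypPoissonKernelCpow_half_eventuallyEq (t : ℝ) {w : ℂ} (hw : 0 < w.im) :
    hypPoissonKernelCpow (1 / 2) t =ᶠ[𝓝 w] fun x => ((routeKernel t x : ℝ) : ℂ) := by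
  filter_upwards [isOpen_upperHalfPlaneSet.mem_nhds hw] with x hx
  exact hypPoissonKernelCpow_one_half (le_of_lt hx)

/-- Hence their real Fréchet derivatives agree on `ℍ` (cast to `ℂ`). -/
theorem fderiv_hypPoissonKernelCpow_half (t : ℝ) {w : ℂ} (hw : 0 < w.im) (v : ℂ) :
    fderiv ℝ (hypPoissonKernelCpow (1 / 2) t) w v = ((fderiv ℝ (routeKernel t) w v : ℝ) : ℂ) := by
  rw [(hypPoissonKernelCpow_half_eventuallyEq t hw).fderiv_eq]
  have h := (Complex.ofRealCLM.hasFDerivAt.comp w (differentiableAt_routeKernel t hw).hasFDerivAt)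
  rw [show (fun x => ((routeKernel t x : ℝ) : ℂ)) = (⇑Complex.ofRealCLM ∘ routeKernel t) from rfl, h.fderiv]
  simp

/-- **Bridge.** The route's inlined period cocycle IS the library's `lewisZagierCocycle (1/2) I u (mapGL γ)`:
same segment `[γ⁻¹ i, i]`, same Green's form once the real kernel and its derivative are identified with
`R(t;·)^{1/2}` and its Wirtinger derivatives. (BruggemanLewisZagier2015, (5.4)–(5.5a)) -/
theorem lzCocycleR_eq (u : ℍ → ℂ) (γ : SL(2, ℤ)) (t : ℝ) :
    lzCocycleR u γ t =
      lewisZagierCocycle (1 / 2) UpperHalfPlane.I u (Matrix.SpecialLinearGroup.mapGL ℝ γ) t := by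
  have hγ : ((Matrix.SpecialLinearGroup.mapGL ℝ γ)⁻¹ • UpperHalfPlane.I : ℍ) = γ⁻¹ • UpperHalfPlane.I := by
    rw [← map_inv]; rfl
  rw [lewisZagierCocycle_apply, hγ, UpperHalfPlane.coe_I]
  unfold lzCocycleR
  refine intervalIntegral.integral_congr fun τ hτ => ?_
  rw [uIcc_of_le zero_le_one] at hτ
  set a : ℂ := ((γ⁻¹ • UpperHalfPlane.I : ℍ) : ℂ) with ha
  have ha_im : 0 < a.im := (γ⁻¹ • UpperHalfPlane.I).im_pos
  set w : ℂ := (1 - (τ : ℂ)) * a + (τ : ℂ) * Complex.I with hw_def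
  have hw : 0 < w.im := by
    simp only [hw_def, Complex.add_im, Complex.mul_im, Complex.sub_re, Complex.one_re, Complex.ofReal_re,
      Complex.sub_im, Complex.one_im, Complex.ofReal_im, sub_zero, zero_mul, add_zero, Complex.I_re,
      Complex.I_im, mul_zero, mul_one]
    rcases eq_or_lt_of_le hτ.1 with h0 | h0
    · rw [← h0]; simpa using ha_im
    · have : 0 ≤ 1 - τ := by linarith [hτ.2]
      nlinarith [mul_nonneg this ha_im.le]
  have hV : hypPoissonKernelCpow (1 / 2) t w = ((routeKernel t w : ℝ) : ℂ) :=
    hypPoissonKernelCpow_one_half hw.le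
  simp only []
  show _ = greenForm (u ∘ UpperHalfPlane.ofComplex) (hypPoissonKernelCpow (1 / 2) t) w (Complex.I - a)
  unfold greenForm wirtingerDz wirtingerDzbar
  rw [hV, fderiv_hypPoissonKernelCpow_half t hw 1, fderiv_hypPoissonKernelCpow_half t hw Complex.I]
  rfl

/-! ## The pieces (children of the split) -/

/-- piece 1 (crux): HECKE STABILITY OF THE QUARTER CUSP FORMS. (DiamondShurman2005, Prop. 5.2.1) -/
def HeckeStableQuarterForms : Prop :=
  let IsQuarterCuspForm : ℕ → (UpperHalfPlane → ℂ) → Prop := fun N u => Literature.NumberTheory.Automorphic.IsC2 u ∧ (∀ γ ∈ CongruenceSubgroup.Gamma1 N, ∀ z : UpperHalfPlane, u (γ • z) = u z) ∧ (∀ z : UpperHalfPlane, Literature.NumberTheory.Automorphic.hypLaplacian u z + (1 / 4 : ℂ) * u z = 0) ∧ ∃ C : ℝ, ∀ z : UpperHalfPlane, ‖u z‖ ≤ C; ∀ N : ℕ, 0 < N → ∀ p : ℕ, p.Prime → ¬ p ∣ N → ∀ σ ∈ CongruenceSubgroup.Gamma0 N, (((σ : Matrix (Fin 2) (Fin 2)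 ℤ) 1 1 : ℤ) : ZMod N) = (p : ZMod N) → ∀ u : UpperHalfPlane → ℂ, IsQuarterCuspForm N u → IsQuarterCuspForm N (fun z : UpperHalfPlane => ((Real.sqrt p : ℝ) : ℂ)⁻¹ * (∑ b ∈ Finset.range p, u (UpperHalfPlane.ofComplex (((z : ℂ) + b) / p)) + u (σ • UpperHalfPlane.ofComplex ((p : ℂ) * (z : ℂ)))))

/-- piece 2 (support): THE COSET PERMUTATION of the `p + 1` Hecke matrices under `Γ₁(N)`. (DiamondShurman2005, §5.2) -/
def HeckeCosetPermutation : Prop :=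
  ∀ N : ℕ, 0 < N → ∀ p : ℕ, p.Prime → ¬ p ∣ N → ∀ σ ∈ CongruenceSubgroup.Gamma0 N, (((σ : Matrix (Fin 2) (Fin 2) ℤ) 1 1 : ℤ) : ZMod N) = (p : ZMod N) → let M : Fin (p + 1) → Matrix (Fin 2) (Fin 2) ℤ := (fun j : Fin (p + 1) => if (j : ℕ) < p then !![(1 : ℤ), ((j : ℕ) : ℤ); 0, (p : ℤ)] else (σ : Matrix (Fin 2) (Fin 2) ℤ) * !![(p : ℤ), 0; 0, 1]); ∀ γ ∈ CongruenceSubgroup.Gamma1 N, ∃ (e : Equiv.Perm (Fin (p + 1))) (δ : Fin (p + 1) → Matrix.SpecialLinearGroup (Fin 2) ℤ), ∀ j : Fin (p + 1), δ j ∈ CongruenceSubgroup.Gamma1 N ∧ M j * (γ : Matrix (Fin 2) (Fin 2) ℤ) = (δ j : Matrix (Fin 2) (Fin 2) ℤ) * M (e j)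

/-- piece 3 (crux): PERIOD INTERTWINING (linearity + BLZ (2.25) pull-back law of the period
integral under the Hecke matrices). (BruggemanLewisZagier2015, (2.25)) -/
def HeckePeriodIntertwining : Prop :=
  let IsQuarterCuspForm : ℕ → (UpperHalfPlane → ℂ) → Prop := fun N u => Literature.NumberTheory.Automorphic.IsC2 u ∧ (∀ γ ∈ CongruenceSubgroup.Gamma1 N, ∀ z : UpperHalfPlane, u (γ • z) = u z) ∧ (∀ z : UpperHalfPlane, Literature.NumberTheory.Automorphic.hypLaplacian u z + (1 / 4 : ℂ) * u z = 0) ∧ ∃ C : ℝ, ∀ z : UpperHalfPlane, ‖u z‖ ≤ C; ∀ N : ℕ, 0 < N → ∀ p : ℕ, p.Prime → ¬ p ∣ N → ∀ σ ∈ CongruenceSubgroup.Gamma0 N, (((σ : Matrix (Fin 2) (Fin 2) ℤ) 1 1 : ℤ) : ZMod N) = (p : ZMod N) → let M : Fin (p + 1) → Matrix (Fin 2) (Fin 2) ℤ := (fun j : Fin (p + 1) => if (j : ℕ) < p then !![(1 : ℤ), ((j : ℕ) : ℤ); 0, (p : ℤ)] else (σ : Matrix (Fin 2) (Fin 2) ℤ)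 * !![(p : ℤ), 0; 0, 1]); let A : Fin (p + 1) → UpperHalfPlane → UpperHalfPlane := (fun (j : Fin (p + 1)) (z : UpperHalfPlane) => if (j : ℕ) < p then UpperHalfPlane.ofComplex (((z : ℂ) + ((j : ℕ) : ℂ)) / (p : ℂ)) else σ • UpperHalfPlane.ofComplex ((p : ℂ) * (z : ℂ))); ∀ u : UpperHalfPlane → ℂ, IsQuarterCuspForm N u → ∀ γ : Matrix.SpecialLinearGroup (Fin 2) ℤ, ∀ᶠ t in Filter.cofinite, Literature.NumberTheory.Automorphic.lewisZagierCocycle (1 / 2) UpperHalfPlane.I (fun z : UpperHalfPlane => ((Real.sqrt p : ℝ) : ℂ)⁻¹ * (∑ b ∈ Finset.range p, u (UpperHalfPlane.ofComplex (((z : ℂ) + b) / p)) + u (σ • UpperHalfPlane.ofComplex ((p : ℂ) * (z : ℂ))))) (Matrix.SpecialLinearGroup.mapGL ℝ γ) t = ∑ j : Fin (p + 1), Literature.NumberTheory.Automorphic.slashHalf (M j) (Literature.NumberTheory.Automorphic.greenPeriod (1 / 2) u (A j (γ⁻¹ • UpperHalfPlane.I)) (A j UpperHalfPlane.I)) t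

/-- glue: the three pieces imply the crux (restated form `HeckePreservesRationalPeriodsR`, which is the route decl
unfolded — see `heckePreservesRationalPeriods_iff` in part 4/4). -/
def HeckePreservesRationalPeriodsOfSubs : Prop :=
  HeckeStableQuarterForms → HeckeCosetPermutation → HeckePeriodIntertwining → HeckePreservesRationalPeriodsR

/-! ## Named forms of the inlined helpers of the pieces -/

/-- The `p + 1` integer Hecke matrices `M_j = (1 j; 0 p)` (`j < p`), `M_p = σ · (p 0; 0 1)`. (DiamondShurman2005, Prop. 5.2.1) -/
def heckeMat (p : ℕ) (σ : SL(2, ℤ)) : Fin (p + 1) → Matrix (Fin 2) (Fin 2) ℤ := (fun j : Fin (p + 1) => if (j : ℕ) < p then !![(1 : ℤ), ((j : ℕ) : ℤ); 0, (p : ℤ)] else (σ : Matrix (Fin 2) (Fin 2) ℤ) * !![(p : ℤ), 0; 0, 1])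

/-- Their action on `ℍ` as written in the route's `T'_p`. -/
def heckeAct (p : ℕ) (σ : SL(2, ℤ)) : Fin (p + 1) → UpperHalfPlane → UpperHalfPlane := (fun (j : Fin (p + 1)) (z : UpperHalfPlane) => if (j : ℕ) < p then UpperHalfPlane.ofComplex (((z : ℂ) + ((j : ℕ) : ℂ)) / (p : ℂ)) else σ • UpperHalfPlane.ofComplex ((p : ℂ) * (z : ℂ)))

/-- The route's normalised Hecke operator `T'_p = p^(-1/2) T_p` (verbatim). -/
def heckeT (p : ℕ) (σ : SL(2, ℤ)) (u : UpperHalfPlane → ℂ) : UpperHalfPlane → ℂ := (fun z : UpperHalfPlane => ((Real.sqrt p : ℝ) : ℂ)⁻¹ * (∑ b ∈ Finset.range p, u (UpperHalfPlane.ofComplex (((z : ℂ) + b) / p)) + u (σ • UpperHalfPlane.ofComplex ((p : ℂ) * (z : ℂ)))))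

/-- Piece 1 over the named helpers (definitional). -/
theorem heckeStableQuarterForms_iff : HeckeStableQuarterForms ↔
    ∀ N : ℕ, 0 < N → ∀ p : ℕ, p.Prime → ¬ p ∣ N → ∀ σ ∈ CongruenceSubgroup.Gamma0 N,
      (((σ : Matrix (Fin 2) (Fin 2) ℤ) 1 1 : ℤ) : ZMod N) = (p : ZMod N) → ∀ u : UpperHalfPlane → ℂ,
        IsQuarterCuspFormR N u → IsQuarterCuspFormR N (heckeT p σ u) := Iff.rfl

/-- Piece 2 over the named helpers (definitional). -/
theorem heckeCosetPermutation_iff : HeckeCosetPermutation ↔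
    ∀ N : ℕ, 0 < N → ∀ p : ℕ, p.Prime → ¬ p ∣ N → ∀ σ ∈ CongruenceSubgroup.Gamma0 N,
      (((σ : Matrix (Fin 2) (Fin 2) ℤ) 1 1 : ℤ) : ZMod N) = (p : ZMod N) →
      ∀ γ ∈ CongruenceSubgroup.Gamma1 N, ∃ (e : Equiv.Perm (Fin (p + 1)))
        (δ : Fin (p + 1) → SL(2, ℤ)), ∀ j : Fin (p + 1), δ j ∈ CongruenceSubgroup.Gamma1 N ∧
          heckeMat p σ j * (γ : Matrix (Fin 2) (Fin 2) ℤ) = (δ j : Matrix (Fin 2) (Fin 2) ℤ) * heckeMat p σ (e j) :=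
  Iff.rfl

/-- Piece 3 over the named helpers (definitional). -/
theorem heckePeriodIntertwining_iff : HeckePeriodIntertwining ↔
    ∀ N : ℕ, 0 < N → ∀ p : ℕ, p.Prime → ¬ p ∣ N → ∀ σ ∈ CongruenceSubgroup.Gamma0 N,
      (((σ : Matrix (Fin 2) (Fin 2) ℤ) 1 1 : ℤ) : ZMod N) = (p : ZMod N) →
      ∀ u : UpperHalfPlane → ℂ, IsQuarterCuspFormR N u → ∀ γ : SL(2, ℤ), ∀ᶠ t in cofinite,
        lewisZagierCocycle (1 / 2) UpperHalfPlane.I (heckeT p σ u) (Matrix.SpecialLinearGroup.mapGL ℝ γ) t =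
          ∑ j : Fin (p + 1), Literature.NumberTheory.Automorphic.slashHalf (heckeMat p σ j)
            (greenPeriod (1 / 2) u (heckeAct p σ j (γ⁻¹ • UpperHalfPlane.I)) (heckeAct p σ j UpperHalfPlane.I)) t :=
  Iff.rfl

/-! ## The Hecke matrices as elements of `GL₂(ℝ)⁺` -/

section HeckeGL

variable (p : ℕ) (σ : SL(2, ℤ))

/-- An integer matrix of non-zero determinant as an element of `GL₂(ℝ)`. -/
theorem map_intCast_mul (A B : Matrix (Fin 2) (Fin 2) ℤ) :
    (A * B).map (Int.cast : ℤ → ℝ) = A.map (Int.cast : ℤ → ℝ) * B.map (Int.cast : ℤ → ℝ) := by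
  ext i j
  simp [Matrix.mul_apply, Fin.sum_univ_two]

/-- `det` commutes with the cast `ℤ → ℝ` of a `2 × 2` matrix. -/
theorem det_map_intCast (M : Matrix (Fin 2) (Fin 2) ℤ) :
    (M.map (Int.cast : ℤ → ℝ)).det = ((M.det : ℤ) : ℝ) := by
  rw [show M.map (Int.cast : ℤ → ℝ) = (Int.castRingHom ℝ).mapMatrix M from rfl, ← RingHom.map_det]
  simp

/-- An integer matrix of non-zero determinant as an element of `GL₂(ℝ)`. -/
def glOfDet (M : Matrix (Fin 2) (Fin 2) ℤ) (h : M.det ≠ 0) : GL (Fin 2) ℝ :=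
  Matrix.GeneralLinearGroup.mkOfDetNeZero (M.map (Int.cast : ℤ → ℝ)) (by
    rw [det_map_intCast]; exact_mod_cast h)

/-- Entries of `glOfDet`. -/
@[simp] theorem glOfDet_apply (M : Matrix (Fin 2) (Fin 2) ℤ) (h : M.det ≠ 0) (i j : Fin 2) :
    (glOfDet M h) i j = ((M i j : ℤ) : ℝ) := rfl

/-- Underlying matrix of `glOfDet`. -/
theorem glOfDet_coe (M : Matrix (Fin 2) (Fin 2) ℤ) (h : M.det ≠ 0) :
    ((glOfDet M h : GL (Fin 2) ℝ) : Matrix (Fin 2) (Fin 2) ℝ) = M.map (Int.cast : ℤ → ℝ) := rfl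

/-- Determinant of `glOfDet`. -/
theorem glOfDet_det (M : Matrix (Fin 2) (Fin 2) ℤ) (h : M.det ≠ 0) :
    (glOfDet M h).det.val = ((M.det : ℤ) : ℝ) := by
  rw [Matrix.GeneralLinearGroup.val_det_apply, glOfDet_coe, det_map_intCast]

variable {p} in
/-- Every Hecke matrix `M_j` has determinant `p`. -/
theorem heckeMat_det (_hp : p.Prime) (j : Fin (p + 1)) : (heckeMat p σ j).det = p := by
  unfold heckeMat
  split_ifs with hj
  · simp [Matrix.det_fin_two_of]
  · rw [Matrix.det_mul, σ.det_coe, Matrix.det_fin_two_of]; ring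

variable {p} in
/-- … hence non-zero determinant. -/
theorem heckeMat_det_ne_zero (hp : p.Prime) (j : Fin (p + 1)) : (heckeMat p σ j).det ≠ 0 := by
  rw [heckeMat_det σ hp j]; exact_mod_cast hp.ne_zero

variable {p} in
/-- The Hecke matrices in `GL₂(ℝ)`. -/
def heckeGL (hp : p.Prime) (j : Fin (p + 1)) : GL (Fin 2) ℝ :=
  glOfDet (heckeMat p σ j) (heckeMat_det_ne_zero σ hp j)

variable {p} in
/-- The Hecke matrices lie in `GL₂(ℝ)⁺`. -/
theorem heckeGL_det_pos (hp : p.Prime) (j : Fin (p + 1)) : 0 < (heckeGL σ hp j).det.val := by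
  unfold heckeGL; rw [glOfDet_det, heckeMat_det σ hp j]; exact_mod_cast hp.pos

variable {p} in
/-- Entries of `heckeGL`. -/
theorem heckeGL_apply (hp : p.Prime) (j : Fin (p + 1)) (i k : Fin 2) :
    (heckeGL σ hp j) i k = ((heckeMat p σ j i k : ℤ) : ℝ) := rfl

/-- The route's `slashHalf` by an integer matrix is the line-model slash at `s = 1/2` by the
corresponding element of `GL₂(ℝ)` (same junk value `0` at the pole). -/
theorem slashHalf_eq_lineSlash (M : Matrix (Fin 2) (Fin 2) ℤ) (h : M.det ≠ 0) (φ : ℝ → ℂ) (t : ℝ) :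
    Literature.NumberTheory.Automorphic.slashHalf M φ t = lineSlash (1 / 2) (glOfDet M h) φ t := by
  rw [lineSlash_one_half]
  rfl

/-- The matrix of `mapGL γ` is the entrywise cast of `γ`. -/
theorem mapGL_coe_eq_map (γ : SL(2, ℤ)) :
    ((Matrix.SpecialLinearGroup.mapGL ℝ γ : GL (Fin 2) ℝ) : Matrix (Fin 2) (Fin 2) ℝ) =
      (γ : Matrix (Fin 2) (Fin 2) ℤ).map (Int.cast : ℤ → ℝ) := by
  ext i j
  rw [Matrix.map_apply]
  exact mapGL_real_apply γ i j

variable {p} in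
/-- Transport of an integer matrix identity `M_j γ = δ M_k` to `GL₂(ℝ)`. -/
theorem heckeGL_mul_eq (hp : p.Prime) {j k : Fin (p + 1)} {γ δ : SL(2, ℤ)}
    (h : heckeMat p σ j * (γ : Matrix (Fin 2) (Fin 2) ℤ) = (δ : Matrix (Fin 2) (Fin 2) ℤ) * heckeMat p σ k) :
    heckeGL σ hp j * Matrix.SpecialLinearGroup.mapGL ℝ γ =
      Matrix.SpecialLinearGroup.mapGL ℝ δ * heckeGL σ hp k := by
  apply Units.ext
  simp only [Units.val_mul, heckeGL, glOfDet_coe, mapGL_coe_eq_map, ← map_intCast_mul, h]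

variable {p} in
/-- The route's action of the `j`-th Hecke matrix is the Möbius action of `heckeGL j`. -/
theorem heckeAct_eq_smul (hp : p.Prime) (j : Fin (p + 1)) (z : ℍ) :
    heckeAct p σ j z = heckeGL σ hp j • z := by
  have hp0 : (0 : ℝ) < p := by exact_mod_cast hp.pos
  unfold heckeAct
  by_cases hj : (j : ℕ) < p
  · rw [if_pos hj]
    have him : 0 < ((((z : ℂ) + ((j : ℕ) : ℂ)) / (p : ℂ))).im := by
      rw [Complex.div_natCast_im]
      simp only [Complex.add_im, UpperHalfPlane.coe_im, Complex.natCast_im, add_zero]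
      exact div_pos z.im_pos hp0
    apply UpperHalfPlane.ext
    rw [UpperHalfPlane.ofComplex_apply_of_im_pos him, UpperHalfPlane.coe_smul_of_det_pos (heckeGL_det_pos σ hp j)]
    simp only [UpperHalfPlane.num, UpperHalfPlane.denom, heckeGL, glOfDet_coe, heckeMat, if_pos hj,
      Matrix.map_apply, Matrix.of_apply, Matrix.cons_val', Matrix.cons_val_zero, Matrix.cons_val_one,
      Matrix.empty_val', Matrix.cons_val_fin_one, Int.cast_one, Int.cast_natCast, Int.cast_zero,
      Complex.ofReal_one, Complex.ofReal_natCast, Complex.ofReal_zero, one_mul, zero_mul, zero_add]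
  · rw [if_neg hj]
    have him : 0 < ((p : ℂ) * (z : ℂ)).im := by
      simp only [Complex.mul_im, Complex.natCast_re, UpperHalfPlane.coe_im, Complex.natCast_im,
        UpperHalfPlane.coe_re, zero_mul, add_zero]
      exact mul_pos hp0 z.im_pos
    have hdetD : (!![(p : ℤ), 0; 0, 1] : Matrix (Fin 2) (Fin 2) ℤ).det ≠ 0 := by
      simp [Matrix.det_fin_two_of]; exact_mod_cast hp.ne_zero
    have hD : glOfDet (!![(p : ℤ), 0; 0, 1]) hdetD • z = UpperHalfPlane.ofComplex ((p : ℂ) * (z : ℂ)) := by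
      apply UpperHalfPlane.ext
      rw [UpperHalfPlane.ofComplex_apply_of_im_pos him, UpperHalfPlane.coe_smul_of_det_pos (by
        rw [glOfDet_det]; simp [Matrix.det_fin_two_of]; exact_mod_cast hp.pos)]
      simp [UpperHalfPlane.num, UpperHalfPlane.denom]
    have hsplit : heckeGL σ hp j = Matrix.SpecialLinearGroup.mapGL ℝ σ * glOfDet (!![(p : ℤ), 0; 0, 1]) hdetD := by
      apply Units.ext
      simp only [Units.val_mul, heckeGL, glOfDet_coe, mapGL_coe_eq_map, ← map_intCast_mul, heckeMat, if_neg hj]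
    rw [hsplit, mul_smul, hD]
    rfl

end HeckeGL

/-! ## Quarter cusp forms are invariant eigenfunctions at `s = 1/2` -/

section Quarter

/-- `Γ₁(N)` inside `GL₂(ℝ)`. -/
abbrev Gamma1GL (N : ℕ) : Subgroup (GL (Fin 2) ℝ) :=
  (CongruenceSubgroup.Gamma1 N).map (Matrix.SpecialLinearGroup.mapGL ℝ)

/-- `mapGL` sends `Γ₁(N)` into its image subgroup `Gamma1GL N ≤ GL₂(ℝ)`. -/
theorem mapGL_mem_Gamma1GL {N : ℕ} {γ : SL(2, ℤ)} (hγ : γ ∈ CongruenceSubgroup.Gamma1 N) :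
    Matrix.SpecialLinearGroup.mapGL ℝ γ ∈ Gamma1GL N :=
  Subgroup.mem_map_of_mem _ hγ

/-- A quarter cusp form on `Γ₁(N)` is a `Gamma1GL N`-invariant eigenfunction with spectral parameter `s = 1/2`
(`s(1-s) = 1/4`), in the library's sense. -/
theorem isInvariantEigenfunction_of_isQuarterCuspFormR {N : ℕ} {u : ℍ → ℂ}
    (hu : IsQuarterCuspFormR N u) : IsInvariantEigenfunction (Gamma1GL N) (1 / 2) u := by
  refine ⟨hu.1, fun z => ?_, ?_⟩
  · have h := hu.2.2.1 z
    rw [← h]; norm_num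
  · rintro _ ⟨γ, hγ, rfl⟩ z
    exact hu.2.1 γ hγ z

/-- `1/2 ≠ 0` in `ℂ`. -/
theorem one_half_ne_zero' : (1 / 2 : ℂ) ≠ 0 := by norm_num
/-- `1/2 ≠ 1` in `ℂ`. -/
theorem one_half_ne_one' : (1 / 2 : ℂ) ≠ 1 := by norm_num

end Quarter

end Summit.Langlands.Langlands.Theorems.HeckeRationalPeriods
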